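import Mathlib

/-!
# A flip multiplier forces a critical departure (crux `LaminatedThreshold`, idea `flip-echo`)

First lemma (`P1`) of the crux idea `Ideas/flip-echo.md` (crux `LaminatedThreshold`, round 2).
Let `p` be the echo map restricted to the unstable axis `(-r, r)` of a threshold profile, continuous
at the fixed point `0` and orientation-REVERSING there (`p t < 0` for `0 < t < r`), and let `D`, `C`
be two disjoint open classes of axis parameters ("disperses", "collapses"), each invariant under
`p` where defined and each containing a non-zero parameter. Then some non-zero parameter lies in
neither class: a critical departure `t⋆ ≠ 0` is forced. With an orientation-preserving `p` the
statement is false (`D = (0, r)`, `C = (-r, 0)`), so the sign is load-bearing.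

The proof is point-set topology: each punctured half-axis is connected, hence lies in one class;
the two halves cannot carry the same class (the other class would be empty off `0`), and they
cannot carry different classes because `p` maps small positive parameters to small negative ones
while preserving the class.
-/

set_option linter.dupNamespace false

namespace Summit.FinalStateConjecture.FinalStateConjecture.Theorems.LaminatedThreshold.Comb

open Set Filter Topology

/-- A punctured half-axis covered by two disjoint open sets lies in one of them. [folklore] -/
theorem Ioo_subset_or_subset_of_subset_union {a b : ℝ} {D C : Set ℝ} (hD : IsOpen D)
    (hC : IsOpen C) (hDC : Disjoint D C) (h : Ioo a b ⊆ D ∪ C) : Ioo a b ⊆ D ∨ Ioo a b ⊆ C :=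
  isPreconnected_Ioo.subset_or_subset hD hC hDC h

/-- **A flip multiplier forces a critical departure** (`P1` of `Ideas/flip-echo.md`).
[folklore] -/
theorem flip_forces_critical_departure : ∀ {r : ℝ}, 0 < r → ∀ {p : ℝ → ℝ}, ContinuousAt p 0 → p 0 = 0 → (∀ t : ℝ, 0 < t → t < r → p t < 0) → ∀ {D C : Set ℝ}, IsOpen D → IsOpen C → Disjoint D C → (∀ t ∈ Set.Ioo (-r) r, p t ∈ Set.Ioo (-r) r → (t ∈ D ↔ p t ∈ D)) → (∀ t ∈ Set.Ioo (-r) r, p t ∈ Set.Ioo (-r) r → (t ∈ C ↔ p t ∈ C)) → (∃ t ∈ Set.Ioo (-r) r, t ≠ 0 ∧ t ∈ D) → (∃ t ∈ Set.Ioo (-r) r, t ≠ 0 ∧ t ∈ C) → ∃ t ∈ Set.Ioo (-r) r, t ≠ 0 ∧ t ∉ D ∧ t ∉ C := by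
  intro r hr p hp hp0 hflip D C hD hC hDC hDinv hCinv hDne hCne
  by_contra hcon
  push Not at hcon
  -- every non-zero parameter is classified
  have hcover : ∀ t ∈ Ioo (-r) r, t ≠ 0 → t ∈ D ∪ C := by
    intro t ht ht0
    by_cases htD : t ∈ D
    · exact Or.inl htD
    · exact Or.inr (hcon t ht ht0 htD)
  have hpos : Ioo 0 r ⊆ D ∪ C := fun t ht ↦ hcover t ⟨by linarith [ht.1], ht.2⟩ ht.1.ne'
  have hneg : Ioo (-r) 0 ⊆ D ∪ C := fun t ht ↦ hcover t ⟨ht.1, by linarith [ht.2]⟩ ht.2.ne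
  -- a small positive parameter flipped into the negative half-axis
  obtain ⟨t₀, ht₀, ht₀r, hpt₀⟩ : ∃ t₀ : ℝ, 0 < t₀ ∧ t₀ < r ∧ p t₀ ∈ Ioo (-r) 0 := by
    obtain ⟨δ, hδ, hδp⟩ := Metric.continuousAt_iff.1 hp r hr
    refine ⟨min (δ / 2) (r / 2), lt_min (by positivity) (by positivity),
      lt_of_le_of_lt (min_le_right _ _) (by linarith), ?_, ?_⟩
    · have hd : dist (min (δ / 2) (r / 2)) 0 < δ := by
        rw [dist_zero_right, Real.norm_eq_abs, abs_of_pos (lt_min (by positivity) (by positivity))]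
        exact lt_of_le_of_lt (min_le_left _ _) (by linarith)
      have h := hδp hd
      rw [hp0, Real.dist_eq, sub_zero] at h
      linarith [(abs_lt.1 h).1]
    · exact hflip _ (lt_min (by positivity) (by positivity))
        (lt_of_le_of_lt (min_le_right _ _) (by linarith))
  have ht₀mem : t₀ ∈ Ioo (-r) r := ⟨by linarith, ht₀r⟩
  have hpt₀mem : p t₀ ∈ Ioo (-r) r := ⟨hpt₀.1, by linarith [hpt₀.2]⟩
  have ht₀pos : t₀ ∈ Ioo 0 r := ⟨ht₀, ht₀r⟩
  -- case analysis on the classes of the two half-axes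
  rcases Ioo_subset_or_subset_of_subset_union hD hC hDC hpos with hP | hP <;>
    rcases Ioo_subset_or_subset_of_subset_union hD hC hDC hneg with hN | hN
  · -- both halves in `D`: `C` has no non-zero parameter
    obtain ⟨t, ht, ht0, htC⟩ := hCne
    rcases lt_or_gt_of_ne ht0 with hlt | hgt
    · exact hDC.le_bot ⟨hN ⟨ht.1, hlt⟩, htC⟩
    · exact hDC.le_bot ⟨hP ⟨hgt, ht.2⟩, htC⟩
  · -- `(0,r) ⊆ D`, `(-r,0) ⊆ C`: flip a small positive parameter
    exact hDC.le_bot ⟨(hDinv t₀ ht₀mem hpt₀mem).1 (hP ht₀pos), hN hpt₀⟩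
  · -- `(0,r) ⊆ C`, `(-r,0) ⊆ D`
    exact hDC.le_bot ⟨hN hpt₀, (hCinv t₀ ht₀mem hpt₀mem).1 (hP ht₀pos)⟩
  · -- both halves in `C`: `D` has no non-zero parameter
    obtain ⟨t, ht, ht0, htD⟩ := hDne
    rcases lt_or_gt_of_ne ht0 with hlt | hgt
    · exact hDC.le_bot ⟨htD, hN ⟨ht.1, hlt⟩⟩
    · exact hDC.le_bot ⟨htD, hP ⟨hgt, ht.2⟩⟩

end Summit.FinalStateConjecture.FinalStateConjecture.Theorems.LaminatedThreshold.Comb
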